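import Summits.Ventures.HSemireg.WedgeWeilCarrier

/-!
# Venture HSemireg — MOD-4 line: the Weil vectors' top product ON THE p4 CARRIER
# (`w₊ ∧ w₋ = (−1)^p · (ℓ_{N-1}∧m_{N-1}) ⋯ (ℓ_0∧m_0)`, i.e. `= (−1)^p · Θ^N/N!`; the pair forms `ℓ_k ∧ m_k` are central)

HONEST FRAMING. Part of the Lean index of the computation cell `pub-hsemireg` (widening group W3, seat w3-mod4-1 gen 6; file of
record `HOME/widen/W3/MOD4-OFFSPLIT-w3mod4.md` §10.1 / §12).  Finite-dimensional exterior algebra over a field ONLY (p4's carrier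
`WedgeCarrierDictionary.lean` / `WedgeWeilCarrier.lean`: a `K`-space `V` with an ADAPTED basis `bV : Fin (N + N) → V`, `ℓ_a := bV a`,
`m_a := bV (N + a)`): no abelian variety, no sheaf, no Ext group, no semiregularity map; nothing here says that HC, HC_CM or HC_AV holds;
no Literature fact is declared or used.  WHAT IS PROVED (proof-only; no definitions): (1) the pair forms `LM k = ℓ_k ∧ m_k` and their
products `LMprod k = (ℓ_{k-1}∧m_{k-1}) ⋯ (ℓ_0∧m_0)` (`= Θ^k/k!` in characteristic `0`, `Θ = Σ_a ℓ_a ∧ m_a`) are CENTRAL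
(`LM_comm`, `LMprod_comm`); (2) block products: `ellprod k * vac k = LMprod k` (no sign), `vac k * ellprod k = (−1)^k · LMprod k`,
`ellprodFrom p k * vacFrom p k * LMprod p = LMprod k` (`p ≤ k`); (3) **the top product of p4's carrier Weil vectors**
`wUp p = ℓ_p ∧ ⋯ ∧ ℓ_{N-1} ∧ m_{p-1} ∧ ⋯ ∧ m_0`, `wLow p = ℓ_0 ∧ ⋯ ∧ ℓ_{p-1} ∧ m_{N-1} ∧ ⋯ ∧ m_p`:
**`wUp p * wLow p = (−1)^p • LMprod N`** (`wUp_mul_wLow`, every `p ≤ N`), so for `w = a·w₊ + b·w₋` the mixed term of `w ∧ w` is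
`(−1)^p·ab · Θ^N/N!` (`smul_wUp_mul_smul_wLow`); (4) `LMprod N ≠ 0` (`LMprod_ne_zero`: it is `Φ_ω(x_0⋯x_{N-1})` for p4's injective
orbit map).  USE (sequel `Mod4CarrierMiddleDegree.lean`): the eigen-parameter of THEOREM R_f's middle degree, transported to the
carrier, is READ OFF this product — the «sign pin» of MOD4-OFFSPLIT §10.1 becomes a kernel identity on the carrier.
All statements and proofs: w3-mod4-1 g6 (2026-08-23).  Namespace `Summit.Ventures.HSemireg.Mod4Carrier`.
References: [BourbakiAlgebre1a3] Ch. III §7 (exterior algebra; graded commutativity).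
-/

open Module

namespace Summit.Ventures.HSemireg.Mod4Carrier

open Summit.Ventures.HSemireg.WedgeBridge Summit.Ventures.HSemireg.WeilCarrier
open ExteriorAlgebra (ι)

variable {K : Type*} [Field K] {N : ℕ} {V : Type*} [AddCommGroup V] [Module K V] (bV : Basis (Fin (N + N)) K V)

/-! ### 1. Products of two generators are central -/

omit [Field K] in
/-- `(ι u ∧ ι v) ∧ ι w = ι w ∧ (ι u ∧ ι v)` (two transpositions). [cite: BourbakiAlgebre1a3, Ch. III §7 no. 1] -/
lemma ι_mul_ι_mul_ι_comm {R : Type*} [CommRing R] [Module R V] (u v w : V) :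
    ι R u * ι R v * ι R w = ι R w * (ι R u * ι R v) := by
  have h1 : ι R v * ι R w = -(ι R w * ι R v) := eq_neg_of_add_eq_zero_left (ExteriorAlgebra.ι_add_mul_swap v w)
  have h2 : ι R u * ι R w = -(ι R w * ι R u) := eq_neg_of_add_eq_zero_left (ExteriorAlgebra.ι_add_mul_swap u w)
  rw [mul_assoc, h1, mul_neg, ← mul_assoc, h2, neg_mul, neg_neg, mul_assoc]

omit [Field K] in
/-- a product of two generators is CENTRAL in the exterior algebra. [cite: BourbakiAlgebre1a3, Ch. III §7 no. 1] -/
lemma ι_mul_ι_comm {R : Type*} [CommRing R] [Module R V] (u v : V) (x : ExteriorAlgebra R V) :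
    ι R u * ι R v * x = x * (ι R u * ι R v) := by
  induction x using ExteriorAlgebra.induction with
  | algebraMap r => exact (Algebra.commutes r _).symm
  | ι w => exact ι_mul_ι_mul_ι_comm u v w
  | mul x y hx hy => rw [← mul_assoc, hx, mul_assoc, hy, mul_assoc]
  | add x y hx hy => rw [mul_add, add_mul, hx, hy]

/-- `LM k = ℓ_k ∧ m_k` is central. -/
lemma LM_comm (k : ℕ) (x : ExteriorAlgebra K V) : LM bV k * x = x * LM bV k := by
  rw [LM]
  exact ι_mul_ι_comm _ _ x

/-- `LMprod k = (ℓ_{k-1}∧m_{k-1}) ⋯ (ℓ_0∧m_0)` is central. -/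
lemma LMprod_comm : ∀ (k : ℕ) (x : ExteriorAlgebra K V), LMprod bV k * x = x * LMprod bV k
  | 0, x => by rw [LMprod, one_mul, mul_one]
  | k + 1, x => by rw [LMprod, mul_assoc, LMprod_comm k x, ← mul_assoc, LM_comm, mul_assoc]

/-- `m_k ∧ ℓ_k = −(ℓ_k ∧ m_k)`. -/
lemma m_mul_ℓ (k : ℕ) : ι K (mN bV k) * ι K (ℓN bV k) = -LM bV k := by
  rw [LM]
  exact eq_neg_of_add_eq_zero_left (ExteriorAlgebra.ι_add_mul_swap _ _)

/-! ### 2. Block products -/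

/-- `(ℓ_0 ∧ ⋯ ∧ ℓ_{k-1}) ∧ (m_{k-1} ∧ ⋯ ∧ m_0) = LMprod k` — nested pairing, NO sign. -/
lemma ellprod_mul_vac : ∀ k : ℕ, ellprod bV k * vac bV k = LMprod bV k
  | 0 => by rw [ellprod, vac, LMprod, mul_one]
  | k + 1 => by
    rw [ellprod, vac, LMprod]
    calc ellprod bV k * ι K (ℓN bV k) * (ι K (mN bV k) * vac bV k)
        = ellprod bV k * LM bV k * vac bV k := by rw [LM]; simp only [mul_assoc]
      _ = LM bV k * (ellprod bV k * vac bV k) := by rw [← LM_comm bV k (ellprod bV k), mul_assoc]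
      _ = LM bV k * LMprod bV k := by rw [ellprod_mul_vac k]

/-- `(m_{k-1} ∧ ⋯ ∧ m_0) ∧ (ℓ_0 ∧ ⋯ ∧ ℓ_{k-1}) = (−1)^k · LMprod k` — nested pairing, one flip per pair. -/
lemma vac_mul_ellprod : ∀ k : ℕ, vac bV k * ellprod bV k = ((-1 : K) ^ k) • LMprod bV k
  | 0 => by rw [ellprod, vac, LMprod, mul_one, pow_zero, one_smul]
  | k + 1 => by
    rw [ellprod, vac, LMprod]
    calc ι K (mN bV k) * vac bV k * (ellprod bV k * ι K (ℓN bV k))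
        = ι K (mN bV k) * (vac bV k * ellprod bV k) * ι K (ℓN bV k) := by simp only [mul_assoc]
      _ = ((-1 : K) ^ k) • (ι K (mN bV k) * LMprod bV k * ι K (ℓN bV k)) := by
          rw [vac_mul_ellprod k, mul_smul_comm, smul_mul_assoc]
      _ = ((-1 : K) ^ k) • (LMprod bV k * (ι K (mN bV k) * ι K (ℓN bV k))) := by
          rw [← LMprod_comm bV k (ι K (mN bV k)), mul_assoc]
      _ = ((-1 : K) ^ (k + 1)) • (LM bV k * LMprod bV k) := by
          rw [m_mul_ℓ, mul_neg, ← LM_comm bV k (LMprod bV k), smul_neg, pow_succ, mul_neg_one, neg_smul]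

/-- the upper-block analogue: `(ℓ_p ∧ ⋯ ∧ ℓ_{k-1}) ∧ (m_{k-1} ∧ ⋯ ∧ m_p) ∧ LMprod p = LMprod k` (`p ≤ k`). -/
lemma ellprodFrom_mul_vacFrom_mul_LMprod (p : ℕ) : ∀ k : ℕ, p ≤ k →
    ellprodFrom bV p k * vacFrom bV p k * LMprod bV p = LMprod bV k
  | 0, h => by
    obtain rfl := Nat.le_zero.mp h
    rw [ellprodFrom, vacFrom, one_mul, one_mul]
  | k + 1, h => by
    by_cases hk : p ≤ k
    · rw [ellprodFrom, vacFrom, if_pos hk, if_pos hk, LMprod]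
      calc ellprodFrom bV p k * ι K (ℓN bV k) * (ι K (mN bV k) * vacFrom bV p k) * LMprod bV p
          = ellprodFrom bV p k * LM bV k * (vacFrom bV p k * LMprod bV p) := by rw [LM]; simp only [mul_assoc]
        _ = LM bV k * (ellprodFrom bV p k * vacFrom bV p k * LMprod bV p) := by
            rw [← LM_comm bV k (ellprodFrom bV p k)]; simp only [mul_assoc]
        _ = LM bV k * LMprod bV k := by rw [ellprodFrom_mul_vacFrom_mul_LMprod p k hk]
    · have hp : p = k + 1 := by omega
      subst hp
      rw [ellprodFrom_of_le bV (le_refl _), vacFrom_of_le bV (le_refl _), one_mul, one_mul]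

/-! ### 3. The top product of the carrier Weil vectors -/

/-- **`w₊ ∧ w₋ = (−1)^p · Θ^N/N!` ON THE CARRIER:** `wUp p * wLow p = (−1)^p • LMprod N` for every `p ≤ N`
(`wUp p = ℓ_p⋯ℓ_{N-1} m_{p-1}⋯m_0`, `wLow p = ℓ_0⋯ℓ_{p-1} m_{N-1}⋯m_p`, `LMprod N = (ℓ_{N-1}∧m_{N-1})⋯(ℓ_0∧m_0)`).
[cite: BourbakiAlgebre1a3, Ch. III §7 no. 1] -/
theorem wUp_mul_wLow {p : ℕ} (hp : p ≤ N) : wUp bV p * wLow bV p = ((-1 : K) ^ p) • LMprod bV N := by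
  rw [wUp, wLow]
  calc ellprodFrom bV p N * vac bV p * (ellprod bV p * vacFrom bV p N)
      = ellprodFrom bV p N * (vac bV p * ellprod bV p) * vacFrom bV p N := by simp only [mul_assoc]
    _ = ((-1 : K) ^ p) • (ellprodFrom bV p N * LMprod bV p * vacFrom bV p N) := by
        rw [vac_mul_ellprod, mul_smul_comm, smul_mul_assoc]
    _ = ((-1 : K) ^ p) • (ellprodFrom bV p N * vacFrom bV p N * LMprod bV p) := by
        rw [mul_assoc, LMprod_comm bV p (vacFrom bV p N), ← mul_assoc]
    _ = ((-1 : K) ^ p) • LMprod bV N := by rw [ellprodFrom_mul_vacFrom_mul_LMprod bV p N hp]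

/-- the mixed term of `w ∧ w` for `w = a·w₊ + b·w₋`: `(a·w₊) ∧ (b·w₋) = ((−1)^p·ab) • Θ^N/N!`. -/
theorem smul_wUp_mul_smul_wLow {p : ℕ} (hp : p ≤ N) (a b : K) :
    (a • wUp bV p) * (b • wLow bV p) = ((-1 : K) ^ p * (a * b)) • LMprod bV N := by
  rw [smul_mul_assoc, mul_smul_comm, wUp_mul_wLow bV hp, smul_smul, smul_smul]
  congr 1
  ring

/-- Weil type `(n,n)`: `(a·w₊) ∧ (b·w₋) = ((−1)ⁿ·ab) • Θ^{2n}/(2n)!`. -/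
theorem smul_wUp_mul_smul_wLow_nn {n : ℕ} (bV : Basis (Fin ((n + n) + (n + n))) K V) (a b : K) :
    (a • wUp bV n) * (b • wLow bV n) = ((-1 : K) ^ n * (a * b)) • LMprod bV (n + n) :=
  smul_wUp_mul_smul_wLow bV (by omega) a b

/-! ### 4. The top pair product is non-zero -/

/-- `x_0 ⋯ x_{N-1} ≠ 0` in `⋀W` (its product with `y_0 ⋯ y_{N-1}` maps to `ℓ_0 ∧ ⋯ ∧ ℓ_{N-1} ≠ 0`). -/
lemma xprod_ne_zero : xprod bV N ≠ 0 := by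
  intro h
  have h1 := Φ_xprod_yprod bV
  rw [h, zero_mul, map_zero] at h1
  exact ellprod_ne_zero bV h1.symm

/-- `LMprod N = Φ_ω(x_0 ⋯ x_{N-1})` (p4's `Φ_xprod` and `ellprod_mul_vac`). -/
lemma LMprod_eq_Φ_xprod : LMprod bV N = Φ K (Lsp bV) (vacuum bV) (xprod bV N) := by
  rw [Φ_xprod, vacuum, ellprod_mul_vac]

/-- **`Θ^N/N! ≠ 0` on the carrier:** `LMprod N ≠ 0`. -/
theorem LMprod_ne_zero : LMprod bV N ≠ 0 := by
  rw [LMprod_eq_Φ_xprod]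
  intro h
  exact xprod_ne_zero bV (Φ_vacuum_injective bV (by rw [h, map_zero]))

/-- hence the scalar `t` in `(a·w₊) ∧ (b·w₋) = t • Θ^N/N!` is `(−1)^p·ab` (and `(−1)ⁿ·ab` in Weil type `(n,n)`). -/
theorem eq_of_smul_wUp_mul_smul_wLow {p : ℕ} (hp : p ≤ N) {a b t : K}
    (ht : (a • wUp bV p) * (b • wLow bV p) = t • LMprod bV N) : t = (-1 : K) ^ p * (a * b) := by
  rw [smul_wUp_mul_smul_wLow bV hp] at ht
  exact (smul_left_injective K (LMprod_ne_zero bV) ht).symm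

end Summit.Ventures.HSemireg.Mod4Carrier
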